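import Mathlib.GroupTheory.FreeGroup.NielsenSchreier
import Mathlib.CategoryTheory.Groupoid.FreeGroupoid
import HarnessLib

/-!
# The free groupoid of a quiver is a free groupoid (`IsFreeGroupoid (Quiver.FreeGroupoid V)`)

Mathlib has two notions side by side: the CONSTRUCTION `Quiver.FreeGroupoid V` of the free groupoid
on a quiver `V` (with its universal property `Quiver.FreeGroupoid.lift` / `lift_unique` towards
arbitrary groupoids), and the PREDICATE `IsFreeGroupoid G` of the Nielsen–Schreier file (a
generating quiver on a copy of `G` such that functors to groups `G ⥤ SingleObj X` are uniquely
determined by labellings of the generating arrows), for which it proves that vertex groups are free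
(`IsFreeGroupoid.SpanningTree.endIsFree`; explicit Schreier basis in the tree's
`FreeGroupoidTreeBasis.lean`).  Mathlib does not connect the two.  This file registers the
instance: `Quiver.FreeGroupoid V` is a free groupoid on the arrows of `V` (generating quiver =
`V`'s arrows, lifted to the universe of the morphisms; `IsFreeGroupoid.of e` = the class of the
arrow `e`), by restricting the universal property to one-object targets — Stallings,
*Topology of finite graphs*, §2.2–2.3 p. 553 ("`π(Γ)` … the fundamental groupoid of `Γ`"; for a
one-vertex graph "`π(Γ) = π₁(Γ, v)` is the free group on `𝒪`").
[cite: Stallings1983, §2.2-2.3 p.553]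

Consequence (not restated here): for a connected quiver the vertex groups
`End ((Quiver.FreeGroupoid.of V).obj v)` — e.g. the fundamental groups of semi-graphs of
`Literature.AnabelianGeometry.SemiGraphs.FundamentalGroup` — are free groups, with the spanning-tree
basis of `FreeGroupoidTreeBasis.lean`.
-/

namespace Literature.GroupTheory.CombinatorialGroupTheory

open CategoryTheory Quiver

universe v u

variable (V : Type u) [Quiver.{v} V]

/-- The vertex of `V` underlying an object of the free groupoid (objects of `Quiver.FreeGroupoid V`
are the vertices of `V`). [cite: Stallings1983, §2.2 p.553] -/
abbrev FreeGroupoidIsFree.vtx (a : IsFreeGroupoid.Generators (Quiver.FreeGroupoid V)) : V := a.as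

/-- A vertex of `V` as a vertex of the generating quiver of `Quiver.FreeGroupoid V`.
[cite: Stallings1983, §2.2 p.553] -/
abbrev FreeGroupoidIsFree.gen (a : V) : IsFreeGroupoid.Generators (Quiver.FreeGroupoid V) :=
  (Quiver.FreeGroupoid.of V).obj a

/-- The generating quiver of `Quiver.FreeGroupoid V`: the arrows of `V`, lifted to the universe of
the morphisms of the free groupoid. [cite: Stallings1983, §2.2 p.553] -/
abbrev FreeGroupoidIsFree.generatorsQuiver :
    Quiver.{max u v} (IsFreeGroupoid.Generators (Quiver.FreeGroupoid V)) :=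
  ⟨fun a b => ULift.{max u v} (FreeGroupoidIsFree.vtx V a ⟶ FreeGroupoidIsFree.vtx V b)⟩

/-- The generating arrow attached to an arrow of `V`. [cite: Stallings1983, §2.2 p.553] -/
abbrev FreeGroupoidIsFree.genHom {a b : V} (e : a ⟶ b) :
    @Quiver.Hom _ (FreeGroupoidIsFree.generatorsQuiver V)
      (FreeGroupoidIsFree.gen V a) (FreeGroupoidIsFree.gen V b) :=
  ULift.up e

/-- **The free groupoid on a quiver is a free groupoid** in the sense of Mathlib's `IsFreeGroupoid`:
generating arrows = the arrows of `V` (universe-lifted), `of e` = the class of `e`, and a functor to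
a group is uniquely determined by the labels of the generating arrows (the universal property
`Quiver.FreeGroupoid.lift` / `lift_unique` restricted to one-object groupoids).
[cite: Stallings1983, §2.2-2.3 p.553] -/
noncomputable instance FreeGroupoidIsFree.isFreeGroupoid :
    IsFreeGroupoid (Quiver.FreeGroupoid V) where
  quiverGenerators := FreeGroupoidIsFree.generatorsQuiver V
  of e := (Quiver.FreeGroupoid.of V).map e.down
  unique_lift {X} _ f := by
    -- the prefunctor `V ⥤q SingleObj X` defined by the labelling
    let φ : V ⥤q CategoryTheory.SingleObj X :=
      { obj := fun _ => CategoryTheory.SingleObj.star X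
        map := fun {a b} e => f (FreeGroupoidIsFree.genHom V e) }
    have hspec : ∀ {a b : V} (e : a ⟶ b),
        (Quiver.FreeGroupoid.lift φ).map ((Quiver.FreeGroupoid.of V).map e) = φ.map e := by
      intro a b e
      change (Paths.lift (Symmetrify.lift φ)).map (Hom.toPos e).toPath = _
      rw [Paths.lift_toPath]
      rfl
    refine ⟨Quiver.FreeGroupoid.lift φ, ?_, ?_⟩
    · rintro ⟨a⟩ ⟨b⟩ ⟨e⟩
      exact hspec e
    · intro G hG
      apply Quiver.FreeGroupoid.lift_unique
      fapply Prefunctor.ext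
      · intro a
        rfl
      · intro a b e
        exact hG ⟨a⟩ ⟨b⟩ ⟨e⟩

/-- The generating arrow of `Quiver.FreeGroupoid V` attached to an arrow `e` of `V` maps, under
`IsFreeGroupoid.of`, to the class `(Quiver.FreeGroupoid.of V).map e` of `e`.
[cite: Stallings1983, §2.2 p.553] -/
theorem FreeGroupoidIsFree.of_genHom {a b : V} (e : a ⟶ b) :
    IsFreeGroupoid.of (G := Quiver.FreeGroupoid V) (FreeGroupoidIsFree.genHom V e) =
      (Quiver.FreeGroupoid.of V).map e :=
  rfl

end Literature.GroupTheory.CombinatorialGroupTheory
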